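import Summits.QuantumFields.YangMills.Theorems.ColdStartUniversalityLatticeLangevinRidgePolarization
import Summits.QuantumFields.YangMills.Theorems.ColdStartUniversalityLatticeLangevinRidgeDeterminacy
import Summits.QuantumFields.YangMills.Theorems.ColdStartUniversalityLatticeLangevinChebyshevSpan
import Summits.QuantumFields.YangMills.Theorems.ColdStartUniversalityLatticeLangevinHeatKernelSU2
import Mathlib.Algebra.BigOperators.Ring.Finset
import HarnessLib

/-!
# Route `ColdStartUniversality`, crux K_A1 `UniformColdStartMixing` (stmt-QuantumFields-24809), rung `stub_fixedCutoffMixing`: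
# G-block, brick N5b — the span of latitude eigenfunctions is the algebra of polynomial observables on `SU(2)^E`

Helper file (seat `ym-line-csu-p1`, g7).  "Ridge form": `F(V) = Σ_l c_l ∏_e U_{m_{l,e}}(⟨ρ g_{l,e}, ρ V_e⟩/2)` (finite sums of
products over the links of latitude eigenfunctions).  Per link, every polynomial in the quaternion coordinates
`q(y) = (Re y₀₀, Im y₀₀, Re y₀₁, Im y₀₁)` is a finite sum of `U_n(⟨ρ g, ρ y⟩/2)` (`exists_ridge_of_mvPolynomial`: polarization
`eval_mvPolynomial_eq_sum_ridge_pow`, every direction is a multiple of some `q(g)` (`exists_smul_hsForm_eq_pairing`), and the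
Chebyshev span `exists_sum_gegenbauerSum_eq_polynomial`), and conversely (`exists_mvPolynomial_of_gegenbauer`).  Hence products
over links of coordinate polynomials are in ridge form (`exists_ridge_of_prod_mvPolynomial`) and ridge form is closed under
products (`exists_ridge_mul`) and sums — the multiplier closure `V·E ⊆ E` and the Stone–Weierstrass input of the ground-state
arguments.  No definition, no sorry.  RECORD-rung R3 plumbing; nothing here bears on the mass gap.
-/

set_option autoImplicit false

noncomputable section

namespace Summit.QuantumFields.YangMills.Theorems.ColdStartUniversality

open Finset
open scoped BigOperators
open Literature.MathematicalPhysics.QuantumFieldTheory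
open Literature.MathematicalPhysics.QuantumLattice (fundamentalRep)
open Literature.Analysis.SpecialFunctions (gegenbauerSum)

/-- The pairing of a coefficient vector with the quaternion coordinates, written out. [folklore] -/
theorem sum_fin_four_quatCoord (v : Fin 4 → ℝ) (y : Matrix.specialUnitaryGroup (Fin 2) ℂ) :
    ∑ j : Fin 4, v j * (![((y : Matrix (Fin 2) (Fin 2) ℂ) 0 0).re, ((y : Matrix (Fin 2) (Fin 2) ℂ) 0 0).im,
        ((y : Matrix (Fin 2) (Fin 2) ℂ) 0 1).re, ((y : Matrix (Fin 2) (Fin 2) ℂ) 0 1).im] : Fin 4 → ℝ) j =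
      v 0 * ((y : Matrix (Fin 2) (Fin 2) ℂ) 0 0).re + v 1 * ((y : Matrix (Fin 2) (Fin 2) ℂ) 0 0).im +
        v 2 * ((y : Matrix (Fin 2) (Fin 2) ℂ) 0 1).re + v 3 * ((y : Matrix (Fin 2) (Fin 2) ℂ) 0 1).im := by
  simp [Fin.sum_univ_four]

/-- **Per link: every coordinate polynomial is a finite sum of latitude eigenfunctions** `U_n(⟨ρ g, ρ y⟩/2)`. [folklore] -/
theorem exists_ridge_of_mvPolynomial (p : MvPolynomial (Fin 4) ℝ) :
    ∃ (κ : Type) (_ : Fintype κ) (c : κ → ℝ) (g : κ → Matrix.specialUnitaryGroup (Fin 2) ℂ) (n : κ → ℕ),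
      ∀ y : Matrix.specialUnitaryGroup (Fin 2) ℂ,
        MvPolynomial.eval (![((y : Matrix (Fin 2) (Fin 2) ℂ) 0 0).re, ((y : Matrix (Fin 2) (Fin 2) ℂ) 0 0).im,
          ((y : Matrix (Fin 2) (Fin 2) ℂ) 0 1).re, ((y : Matrix (Fin 2) (Fin 2) ℂ) 0 1).im] : Fin 4 → ℝ) p =
        ∑ l, c l * gegenbauerSum 1 (n l) (hsForm 2 (fundamentalRep (Fin 2) (g l)) (fundamentalRep (Fin 2) y) / 2) := by
  classical
  obtain ⟨κ, _, c, v, k, h⟩ := eval_mvPolynomial_eq_sum_ridge_pow p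
  -- each direction is a multiple of a group direction
  choose r g hrg using fun l : κ => exists_smul_hsForm_eq_pairing (v l)
  -- each power of the latitude is a Chebyshev sum
  choose N d hNd using fun l : κ => exists_sum_gegenbauerSum_eq_polynomial ((Polynomial.C (r l) * Polynomial.X) ^ (k l))
  refine ⟨Σ l : κ, Fin (N l), inferInstance, fun s => c s.1 * d s.1 s.2, fun s => g s.1, fun s => s.2, fun y => ?_⟩
  rw [h, Fintype.sum_sigma]
  refine Finset.sum_congr rfl fun l _ => ?_
  rw [sum_fin_four_quatCoord, hrg l y]
  have hpow : (r l * (hsForm 2 (fundamentalRep (Fin 2) (g l)) (fundamentalRep (Fin 2) y) / 2)) ^ k l =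
      ((Polynomial.C (r l) * Polynomial.X) ^ (k l)).eval
        (hsForm 2 (fundamentalRep (Fin 2) (g l)) (fundamentalRep (Fin 2) y) / 2) := by
    simp [Polynomial.eval_pow, Polynomial.eval_mul]
  rw [hpow, hNd l, Finset.mul_sum, Finset.sum_range]
  exact Finset.sum_congr rfl fun i _ => by ring

/-- **Per link, conversely: a latitude eigenfunction is a coordinate polynomial.** [folklore] -/
theorem exists_mvPolynomial_of_gegenbauer (g : Matrix.specialUnitaryGroup (Fin 2) ℂ) (n : ℕ) :
    ∃ p : MvPolynomial (Fin 4) ℝ, ∀ y : Matrix.specialUnitaryGroup (Fin 2) ℂ,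
      gegenbauerSum 1 n (hsForm 2 (fundamentalRep (Fin 2) g) (fundamentalRep (Fin 2) y) / 2) =
        MvPolynomial.eval (![((y : Matrix (Fin 2) (Fin 2) ℂ) 0 0).re, ((y : Matrix (Fin 2) (Fin 2) ℂ) 0 0).im,
          ((y : Matrix (Fin 2) (Fin 2) ℂ) 0 1).re, ((y : Matrix (Fin 2) (Fin 2) ℂ) 0 1).im] : Fin 4 → ℝ) p := by
  classical
  -- the latitude as a linear coordinate polynomial
  set ℓ : MvPolynomial (Fin 4) ℝ :=
    MvPolynomial.C (((g : Matrix (Fin 2) (Fin 2) ℂ) 0 0).re) * MvPolynomial.X 0 +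
      MvPolynomial.C (((g : Matrix (Fin 2) (Fin 2) ℂ) 0 0).im) * MvPolynomial.X 1 +
      MvPolynomial.C (((g : Matrix (Fin 2) (Fin 2) ℂ) 0 1).re) * MvPolynomial.X 2 +
      MvPolynomial.C (((g : Matrix (Fin 2) (Fin 2) ℂ) 0 1).im) * MvPolynomial.X 3 with hℓ
  have hℓeval : ∀ y : Matrix.specialUnitaryGroup (Fin 2) ℂ,
      MvPolynomial.eval (![((y : Matrix (Fin 2) (Fin 2) ℂ) 0 0).re, ((y : Matrix (Fin 2) (Fin 2) ℂ) 0 0).im,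
          ((y : Matrix (Fin 2) (Fin 2) ℂ) 0 1).re, ((y : Matrix (Fin 2) (Fin 2) ℂ) 0 1).im] : Fin 4 → ℝ) ℓ =
        hsForm 2 (fundamentalRep (Fin 2) g) (fundamentalRep (Fin 2) y) / 2 := by
    intro y
    rw [← quatCoord_pairing_eq_hsForm g y, hℓ]
    simp
  refine ⟨Polynomial.aeval ℓ (Polynomial.Chebyshev.U ℝ (n : ℤ)), fun y => ?_⟩
  rw [gegenbauerSum_one_eq_chebyshevU]
  change _ = MvPolynomial.aeval _ (Polynomial.aeval ℓ (Polynomial.Chebyshev.U ℝ (n : ℤ)))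
  rw [← Polynomial.aeval_algHom_apply]
  have hs : MvPolynomial.aeval (![((y : Matrix (Fin 2) (Fin 2) ℂ) 0 0).re, ((y : Matrix (Fin 2) (Fin 2) ℂ) 0 0).im,
      ((y : Matrix (Fin 2) (Fin 2) ℂ) 0 1).re, ((y : Matrix (Fin 2) (Fin 2) ℂ) 0 1).im] : Fin 4 → ℝ) ℓ =
      hsForm 2 (fundamentalRep (Fin 2) g) (fundamentalRep (Fin 2) y) / 2 := by
    rw [← hℓeval y]; rfl
  rw [hs]
  exact (congrFun (Polynomial.coe_aeval_eq_eval _) _).symm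

variable {L : ℕ} [NeZero L]

/-- **Products over the links of coordinate polynomials are in ridge form.** [folklore] -/
theorem exists_ridge_of_prod_mvPolynomial (P : Edge 3 L → MvPolynomial (Fin 4) ℝ) :
    ∃ (κ : Type) (_ : Fintype κ) (c : κ → ℝ) (g : κ → Edge 3 L → Matrix.specialUnitaryGroup (Fin 2) ℂ)
      (m : κ → Edge 3 L → ℕ), ∀ V : GaugeConfig 3 L (Matrix.specialUnitaryGroup (Fin 2) ℂ),
      ∏ e, MvPolynomial.eval (![((V e : Matrix (Fin 2) (Fin 2) ℂ) 0 0).re, ((V e : Matrix (Fin 2) (Fin 2) ℂ) 0 0).im,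
          ((V e : Matrix (Fin 2) (Fin 2) ℂ) 0 1).re, ((V e : Matrix (Fin 2) (Fin 2) ℂ) 0 1).im] : Fin 4 → ℝ) (P e) =
        ∑ l, c l * ∏ e, gegenbauerSum 1 (m l e)
          (hsForm 2 (fundamentalRep (Fin 2) (g l e)) (fundamentalRep (Fin 2) (V e)) / 2) := by
  classical
  choose κ hκ c g n h using fun e : Edge 3 L => exists_ridge_of_mvPolynomial (P e)
  letI : ∀ e, Fintype (κ e) := hκ
  refine ⟨∀ e, κ e, inferInstance, fun x => ∏ e, c e (x e), fun x e => g e (x e), fun x e => n e (x e), fun V => ?_⟩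
  simp_rw [h]
  rw [Fintype.prod_sum (fun e l => c e l * gegenbauerSum 1 (n e l)
    (hsForm 2 (fundamentalRep (Fin 2) (g e l)) (fundamentalRep (Fin 2) (V e)) / 2))]
  refine Finset.sum_congr rfl fun x _ => ?_
  rw [← Finset.prod_mul_distrib]

/-- Ridge form is closed under sums. [folklore] -/
theorem exists_ridge_add {F G : GaugeConfig 3 L (Matrix.specialUnitaryGroup (Fin 2) ℂ) → ℝ}
    (hF : ∃ (κ : Type) (_ : Fintype κ) (c : κ → ℝ) (g : κ → Edge 3 L → Matrix.specialUnitaryGroup (Fin 2) ℂ)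
      (m : κ → Edge 3 L → ℕ), ∀ V, F V = ∑ l, c l * ∏ e, gegenbauerSum 1 (m l e)
        (hsForm 2 (fundamentalRep (Fin 2) (g l e)) (fundamentalRep (Fin 2) (V e)) / 2))
    (hG : ∃ (κ : Type) (_ : Fintype κ) (c : κ → ℝ) (g : κ → Edge 3 L → Matrix.specialUnitaryGroup (Fin 2) ℂ)
      (m : κ → Edge 3 L → ℕ), ∀ V, G V = ∑ l, c l * ∏ e, gegenbauerSum 1 (m l e)
        (hsForm 2 (fundamentalRep (Fin 2) (g l e)) (fundamentalRep (Fin 2) (V e)) / 2)) :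
    ∃ (κ : Type) (_ : Fintype κ) (c : κ → ℝ) (g : κ → Edge 3 L → Matrix.specialUnitaryGroup (Fin 2) ℂ)
      (m : κ → Edge 3 L → ℕ), ∀ V, F V + G V = ∑ l, c l * ∏ e, gegenbauerSum 1 (m l e)
        (hsForm 2 (fundamentalRep (Fin 2) (g l e)) (fundamentalRep (Fin 2) (V e)) / 2) := by
  obtain ⟨κ₁, _, c₁, g₁, m₁, h₁⟩ := hF
  obtain ⟨κ₂, _, c₂, g₂, m₂, h₂⟩ := hG
  refine ⟨κ₁ ⊕ κ₂, inferInstance, Sum.elim c₁ c₂, Sum.elim g₁ g₂, Sum.elim m₁ m₂, fun V => ?_⟩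
  rw [h₁ V, h₂ V, Fintype.sum_sum_type]
  simp only [Sum.elim_inl, Sum.elim_inr]

/-- Ridge form is closed under scalars. [folklore] -/
theorem exists_ridge_smul {F : GaugeConfig 3 L (Matrix.specialUnitaryGroup (Fin 2) ℂ) → ℝ} (a : ℝ)
    (hF : ∃ (κ : Type) (_ : Fintype κ) (c : κ → ℝ) (g : κ → Edge 3 L → Matrix.specialUnitaryGroup (Fin 2) ℂ)
      (m : κ → Edge 3 L → ℕ), ∀ V, F V = ∑ l, c l * ∏ e, gegenbauerSum 1 (m l e)
        (hsForm 2 (fundamentalRep (Fin 2) (g l e)) (fundamentalRep (Fin 2) (V e)) / 2)) :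
    ∃ (κ : Type) (_ : Fintype κ) (c : κ → ℝ) (g : κ → Edge 3 L → Matrix.specialUnitaryGroup (Fin 2) ℂ)
      (m : κ → Edge 3 L → ℕ), ∀ V, a * F V = ∑ l, c l * ∏ e, gegenbauerSum 1 (m l e)
        (hsForm 2 (fundamentalRep (Fin 2) (g l e)) (fundamentalRep (Fin 2) (V e)) / 2) := by
  obtain ⟨κ, _, c, g, m, h⟩ := hF
  refine ⟨κ, inferInstance, fun l => a * c l, g, m, fun V => ?_⟩
  rw [h V, Finset.mul_sum]
  exact Finset.sum_congr rfl fun l _ => by ring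

/-- Constants are in ridge form (`U_0 = 1`). [folklore] -/
theorem exists_ridge_const (a : ℝ) :
    ∃ (κ : Type) (_ : Fintype κ) (c : κ → ℝ) (g : κ → Edge 3 L → Matrix.specialUnitaryGroup (Fin 2) ℂ)
      (m : κ → Edge 3 L → ℕ), ∀ V : GaugeConfig 3 L (Matrix.specialUnitaryGroup (Fin 2) ℂ),
      a = ∑ l, c l * ∏ e, gegenbauerSum 1 (m l e)
        (hsForm 2 (fundamentalRep (Fin 2) (g l e)) (fundamentalRep (Fin 2) (V e)) / 2) := by
  refine ⟨Unit, inferInstance, fun _ => a, fun _ _ => 1, fun _ _ => 0, fun V => ?_⟩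
  simp [Literature.Analysis.SpecialFunctions.gegenbauerSum_zero]

/-- **Ridge form is closed under products** (per-link product of latitude eigenfunctions is a coordinate polynomial, hence a
sum of eigenfunctions; distribute over the links). [folklore] -/
theorem exists_ridge_mul {F G : GaugeConfig 3 L (Matrix.specialUnitaryGroup (Fin 2) ℂ) → ℝ}
    (hF : ∃ (κ : Type) (_ : Fintype κ) (c : κ → ℝ) (g : κ → Edge 3 L → Matrix.specialUnitaryGroup (Fin 2) ℂ)
      (m : κ → Edge 3 L → ℕ), ∀ V, F V = ∑ l, c l * ∏ e, gegenbauerSum 1 (m l e)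
        (hsForm 2 (fundamentalRep (Fin 2) (g l e)) (fundamentalRep (Fin 2) (V e)) / 2))
    (hG : ∃ (κ : Type) (_ : Fintype κ) (c : κ → ℝ) (g : κ → Edge 3 L → Matrix.specialUnitaryGroup (Fin 2) ℂ)
      (m : κ → Edge 3 L → ℕ), ∀ V, G V = ∑ l, c l * ∏ e, gegenbauerSum 1 (m l e)
        (hsForm 2 (fundamentalRep (Fin 2) (g l e)) (fundamentalRep (Fin 2) (V e)) / 2)) :
    ∃ (κ : Type) (_ : Fintype κ) (c : κ → ℝ) (g : κ → Edge 3 L → Matrix.specialUnitaryGroup (Fin 2) ℂ)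
      (m : κ → Edge 3 L → ℕ), ∀ V, F V * G V = ∑ l, c l * ∏ e, gegenbauerSum 1 (m l e)
        (hsForm 2 (fundamentalRep (Fin 2) (g l e)) (fundamentalRep (Fin 2) (V e)) / 2) := by
  classical
  obtain ⟨κ₁, _, c₁, g₁, m₁, h₁⟩ := hF
  obtain ⟨κ₂, _, c₂, g₂, m₂, h₂⟩ := hG
  -- per pair of terms and per link, the product of the two eigenfunctions is a coordinate polynomial
  choose p₁ hp₁ using fun (l : κ₁) (e : Edge 3 L) => exists_mvPolynomial_of_gegenbauer (g₁ l e) (m₁ l e)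
  choose p₂ hp₂ using fun (l : κ₂) (e : Edge 3 L) => exists_mvPolynomial_of_gegenbauer (g₂ l e) (m₂ l e)
  choose κ hκ c g n h using fun ll : κ₁ × κ₂ => exists_ridge_of_prod_mvPolynomial (L := L) (fun e => p₁ ll.1 e * p₂ ll.2 e)
  letI : ∀ ll, Fintype (κ ll) := hκ
  refine ⟨Σ ll : κ₁ × κ₂, κ ll, inferInstance, fun s => c₁ s.1.1 * c₂ s.1.2 * c s.1 s.2, fun s => g s.1 s.2,
    fun s => n s.1 s.2, fun V => ?_⟩
  have hterm : ∀ ll : κ₁ × κ₂,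
      (∏ e, gegenbauerSum 1 (m₁ ll.1 e) (hsForm 2 (fundamentalRep (Fin 2) (g₁ ll.1 e)) (fundamentalRep (Fin 2) (V e)) / 2)) *
        (∏ e, gegenbauerSum 1 (m₂ ll.2 e) (hsForm 2 (fundamentalRep (Fin 2) (g₂ ll.2 e)) (fundamentalRep (Fin 2) (V e)) / 2)) =
      ∑ l, c ll l * ∏ e, gegenbauerSum 1 (n ll l e)
        (hsForm 2 (fundamentalRep (Fin 2) (g ll l e)) (fundamentalRep (Fin 2) (V e)) / 2) := by
    intro ll
    rw [← h ll V, ← Finset.prod_mul_distrib]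
    refine Finset.prod_congr rfl fun e _ => ?_
    rw [hp₁, hp₂, map_mul]
  rw [h₁ V, h₂ V, Finset.sum_mul_sum, Fintype.sum_sigma, Fintype.sum_prod_type]
  refine Finset.sum_congr rfl fun l₁ _ => Finset.sum_congr rfl fun l₂ _ => ?_
  rw [mul_mul_mul_comm, hterm (l₁, l₂), Finset.mul_sum]
  exact Finset.sum_congr rfl fun l _ => by ring

end Summit.QuantumFields.YangMills.Theorems.ColdStartUniversality

end
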